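import Summits.CriticalPhenomena.PercolationContinuityZ3.Theorems.PercNearOneGluingNoHeavyQuantConvWindow
import Summits.CriticalPhenomena.PercolationContinuityZ3.Theorems.PercNearOneGluingNoHeavyQuantSliceLawSWHolds
import Summits.CriticalPhenomena.PercolationContinuityZ3.Theorems.PercNearOneGluingNoHeavyQuantSingleLowCapacity
import HarnessLib

/-!
# QUANT lane R8, T-DEC: `ConvClosedT` HOLDS WHEN ONE FACTOR HAS AT MOST TWO ATOMS (the window hypotheses on a two-point law force a datum
# without light straddlers, so the one-sided convolution closure applies)

builds on p205010 (kernel theorem, internal audit signed; external expert review pending)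

Support file (`--supports stmt-CriticalPhenomena-4575`), QUANT lane seat prim-quant-census-1 (gen 20), rung R8 of
`run/shared/lean/prim/quant/LADDER.md`.  Theorems only, standard axioms, no sorries.  Memo `run/shared/lean/prim/quant/prim-quant-census-1/CONV-G20.md` §8.

THE POINT.  Lead g22's `LawDec.ConvClosedT` asks that `lconv μ₁ μ₂` be DEC at `(T₁ + T₂, j)` when each factor is DEC at its own target on the window
of layers `[j − M_other, j]`.  The one-sided theorem (`lconv_decAtT_of_window_bdecAtT`, census-1 g20, with `SliceClosedWindowT` = the typer's
`sliceClosedWindowT_holds`) needs a datum of `μ₂` at layer `j` WITHOUT LIGHT STRADDLERS (`BDECAtT x T₂ j M₂ M₁ μ₂`).  For a TWO-POINT law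
`μ₂ = {q, h; c}` the window hypotheses themselves supply such a datum (`twoPoint_bdecAtT`): weak duality priced at the single low `q`
(`low_capacity_of_decAtT`, lead g22) at layer `j` gives `pairGate(q,h) ≤ c` for a mid `h ≤ j` (resp. `x ≤ c` for a giant `h > j`), and — exactly when
`h` STRADDLES (`j < h + M₁`) — the layer `h − 1` lies in the window and there `h` is a giant, so `x ≤ c`: the pair is heavy-valid.  A non-straddling
light pair is B-valid as it stands.  Hence **`ConvClosedT` holds whenever one factor is supported on at most two points**
(`lconv_decAtT_of_window_twoPoint`), for every position `q < h ≤ M₂`, every mass `0 ≤ c ≤ 1` and every real target `T₂` — the two-point case of the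
cone statement, generalising `SliceClosedWindowT` (the blob `{0, a; g}`, `x ≤ g`, `T₂ = a·g`).  By the vertex principle (memo §8 (2): the conclusion is
convex in `μ₂` and `lconv` is bilinear) the first laws NOT covered are the three-atom vertices of the window polytope with two lows sharing one
absorber, tight in two layer regimes (memo §8 (2), e.g. `{0: 5/147, 1: 31/49, 6: 1/3}` at `x = 1/3`, `T₂ = 7/2`).

* `LawDec.twoPoint_giant_ge`, `LawDec.twoPoint_mid_ge`, `LawDec.twoPoint_notLow_of_one` — what DEC of `{q, h; c}` at one layer says about `c`.
* **`LawDec.twoPoint_bdecAtT`** — the window hypotheses make `{q, h; c}` a `BDECAtT` datum relative to `M₁`.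
* **`LawDec.lconv_decAtT_of_window_twoPoint`** — `ConvClosedT` for a two-point second factor.

[this work].  Nothing here is cited as a published result.  The gluing rows served [cite: KozmaNitzan2024, Conjecture 3 (p. 15)]; product measure
[cite: Grimmett1999, §1.3 p. 10].
-/

noncomputable section

namespace Summit.CriticalPhenomena.PercolationContinuityZ3.Theorems

namespace Quant

open Finset

/-- the two-point law `{lo, hi; g}` (as in `…QuantLawDEC`) -/
local notation3 "TP[" lo ", " hi ", " g ", " h "]" =>
  (g : ℝ) * (if (h : ℕ) = (hi : ℕ) then (1 : ℝ) else 0) + (1 - (g : ℝ)) * (if (h : ℕ) = (lo : ℕ) then (1 : ℝ) else 0)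

namespace LawDec

/-! ### Bookkeeping -/

/-- `Σ_{k ≤ N} F k · TP[q, h, c, k] = c·F h + (1 − c)·F q`. [folklore] -/
private theorem sum_mul_twoPoint (F : ℕ → ℝ) (N q h : ℕ) (c : ℝ) (hq : q ≤ N) (hh : h ≤ N) :
    ∑ k ∈ Finset.range (N + 1), F k * TP[q, h, c, k] = c * F h + (1 - c) * F q := by
  have e : ∀ k ∈ Finset.range (N + 1),
      F k * TP[q, h, c, k] = c * (if k = h then F k else 0) + (1 - c) * (if k = q then F k else 0) := by
    intro k _
    split_ifs <;> ring
  rw [Finset.sum_congr rfl e, Finset.sum_add_distrib, ← Finset.mul_sum, ← Finset.mul_sum, Finset.sum_ite_eq', Finset.sum_ite_eq',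
    if_pos (Finset.mem_range.2 (by omega)), if_pos (Finset.mem_range.2 (by omega))]

/-- the two-point law is nonnegative for `0 ≤ c ≤ 1`. -/
private theorem twoPoint_nonneg (q h : ℕ) (c : ℝ) (hc0 : 0 ≤ c) (hc1 : c ≤ 1) (k : ℕ) : 0 ≤ TP[q, h, c, k] := by
  have : 0 ≤ 1 - c := by linarith
  positivity

/-! ### What DEC of a two-point law at one layer says about the absorber mass -/

/-- **giant absorber**: if `{q, h; c}` is DEC at a layer `j′` where `q` is low and `h ≥ j′ + 1` is a giant, then `x ≤ c`
(capacity of the single low `q`: `(x/(1−x))(1−c) ≤ c`). [this work] -/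
theorem twoPoint_giant_ge (x T c : ℝ) (j' M q h : ℕ) (hx0 : 0 < x) (hx1 : x < 1) (hc0 : 0 ≤ c) (hc1 : c ≤ 1)
    (hqh : q < h) (hhM : h ≤ M) (hqj : q ≤ j') (hlow : 2 * (q : ℝ) < T) (hgt : j' + 1 ≤ h)
    (hdec : DECAtT x T j' M (fun k => TP[q, h, c, k])) : x ≤ c := by
  have key := low_capacity_of_decAtT x T j' M q (fun k => TP[q, h, c, k]) hx0 hx1 (twoPoint_nonneg q h c hc0 hc1) hdec hqj hlow
  rw [sum_mul_twoPoint _ M q h c (by omega) hhM] at key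
  have hqq : capCoef x T j' q q = 0 := by
    unfold capCoef
    rw [if_neg (by omega), if_neg (fun hand => by linarith [hand.1])]
  have hhh : capCoef x T j' q h = 1 := by
    unfold capCoef
    rw [if_pos hgt]
  have eq : TP[q, h, c, q] = 1 - c := by
    rw [if_neg (by omega), if_pos rfl]; ring
  rw [hqq, hhh, eq] at key
  -- key : x/(1-x) * (1-c) ≤ c * 1 + (1-c) * 0
  have h1x : 0 < 1 - x := by linarith
  have e2 : x / (1 - x) * (1 - c) = x * (1 - c) / (1 - x) := by ring
  rw [e2, div_le_iff₀ h1x] at key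
  nlinarith

/-- **mid absorber**: if `{q, h; c}` is DEC at a layer `j′ ≥ h` where `q` is low, then either `c = 1`, or `h` is a compatible mid
(`T ≤ 2h`, `T < q + h`) and the minimal gate is affordable: `pairGate x T q h ≤ c`. [this work] -/
theorem twoPoint_mid_ge (x T c : ℝ) (j' M q h : ℕ) (hx0 : 0 < x) (hx1 : x < 1) (hc0 : 0 ≤ c) (hc1 : c ≤ 1)
    (hqh : q < h) (hhM : h ≤ M) (hqj : q ≤ j') (hlow : 2 * (q : ℝ) < T) (hhj : h ≤ j')
    (hdec : DECAtT x T j' M (fun k => TP[q, h, c, k])) :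
    c = 1 ∨ (T ≤ 2 * (h : ℝ) ∧ T < (q : ℝ) + h ∧ pairGate x T q h ≤ c) := by
  have key := low_capacity_of_decAtT x T j' M q (fun k => TP[q, h, c, k]) hx0 hx1 (twoPoint_nonneg q h c hc0 hc1) hdec hqj hlow
  rw [sum_mul_twoPoint _ M q h c (by omega) hhM] at key
  have hqq : capCoef x T j' q q = 0 := by
    unfold capCoef
    rw [if_neg (by omega), if_neg (fun hand => by linarith [hand.1])]
  have eq : TP[q, h, c, q] = 1 - c := by
    rw [if_neg (by omega), if_pos rfl]; ring
  rw [hqq, eq] at key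
  have h1x : 0 < 1 - x := by linarith
  have hu : 0 < x / (1 - x) := div_pos hx0 h1x
  have hng : ¬ (j' + 1 ≤ h) := by omega
  by_cases hm : T ≤ 2 * (h : ℝ) ∧ T < (q : ℝ) + h
  · -- compatible mid: capCoef = u / usage, usage = γ/(1-γ), γ = pairGate
    right
    refine ⟨hm.1, hm.2, ?_⟩
    have hcap : capCoef x T j' q h = (x / (1 - x)) / usage x T j' q h := by
      unfold capCoef
      rw [if_neg hng, if_pos hm]
    have hus : usage x T j' q h = pairGate x T q h / (1 - pairGate x T q h) := by
      simp only [usage, gateOf, if_neg hng]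
    have hγ0 : 0 < pairGate x T q h := pairGate_pos x T q h hlow hqh
    have hγ1 : pairGate x T q h < 1 := pairGate_lt_one x T q h hx0 hx1 hlow hm.2
    rw [hcap, hus] at key
    -- key : u (1-c) ≤ c * (u / (γ/(1-γ))) + (1-c) * 0
    have e3 : x / (1 - x) / (pairGate x T q h / (1 - pairGate x T q h)) = (x / (1 - x)) * ((1 - pairGate x T q h) / pairGate x T q h) := by
      rw [div_eq_mul_inv, inv_div]
    have e4 : c * ((x / (1 - x)) * ((1 - pairGate x T q h) / pairGate x T q h)) + (1 - c) * 0
        = (x / (1 - x)) * (c * (1 - pairGate x T q h) / pairGate x T q h) := by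
      ring
    rw [e3, e4] at key
    have key2 : 1 - c ≤ c * (1 - pairGate x T q h) / pairGate x T q h := le_of_mul_le_mul_left key hu
    rw [le_div_iff₀ hγ0] at key2
    nlinarith
  · -- no absorber for q: capCoef = 0, so c = 1
    left
    have hcap : capCoef x T j' q h = 0 := by
      unfold capCoef
      rw [if_neg hng, if_neg hm]
    rw [hcap] at key
    have e2 : x / (1 - x) * (1 - c) = x * (1 - c) / (1 - x) := by ring
    rw [e2, div_le_iff₀ h1x] at key
    nlinarith

/-- **the top of a DEC point mass is not low**: if `c = 1` (the law is `δ_h`) and `δ_h` is DEC at a layer `j′ ≥ h`, then `T ≤ 2h`. [this work] -/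
theorem twoPoint_notLow_of_one (x T : ℝ) (j' M q h : ℕ) (hx0 : 0 < x) (hx1 : x < 1) (hqh : q < h) (hhM : h ≤ M) (hhj : h ≤ j')
    (hdec : DECAtT x T j' M (fun k => TP[q, h, (1 : ℝ), k])) : T ≤ 2 * (h : ℝ) := by
  by_contra hlt
  push Not at hlt
  have key := low_capacity_of_decAtT x T j' M h (fun k => TP[q, h, (1 : ℝ), k]) hx0 hx1
    (twoPoint_nonneg q h 1 zero_le_one le_rfl) hdec hhj hlt
  rw [sum_mul_twoPoint _ M q h 1 (by omega) hhM] at key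
  have hhh : capCoef x T j' h h = 0 := by
    unfold capCoef
    rw [if_neg (by omega), if_neg (fun hand => by linarith [hand.1])]
  have eq : TP[q, h, (1 : ℝ), h] = 1 := by
    rw [if_pos rfl]; ring
  rw [hhh, eq] at key
  have h1x : 0 < 1 - x := by linarith
  have hu : 0 < x / (1 - x) := div_pos hx0 h1x
  linarith

/-! ### The window hypotheses make a two-point law a datum without light straddlers -/

/-- **THE TWO-POINT DATUM.**  For `0 < x < 1`, positions `q < h ≤ M₂`, a mass `0 ≤ c ≤ 1` and any real target `T₂`: if the two-point law
`{q, h; c}` is DEC at target `T₂` at every layer `j″ ≤ j` with `j ≤ j″ + M₁`, then it is a `BDECAtT` datum at layer `j` relative to `M₁` (no light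
straddler).  Cases: `q` not a `j`-low — the pair has a self-sufficient `lo`; `c = 1` — the law is `δ_h` with `h` self-sufficient or a giant; `h > j` —
`x ≤ c` from the layer `j`; `h ≤ j` straddling (`j < h + M₁`) — `pairGate ≤ c` from the layer `j` and `x ≤ c` from the window layer `h − 1`, so the pair is
heavy-valid; `h + M₁ ≤ j` — heavy-valid if `x ≤ c`, else a light credit pair below the straddle line. [this work] -/
theorem twoPoint_bdecAtT (x T₂ c : ℝ) (j M₁ M₂ q h : ℕ) (hx0 : 0 < x) (hx1 : x < 1) (hc0 : 0 ≤ c) (hc1 : c ≤ 1)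
    (hqh : q < h) (hhM : h ≤ M₂)
    (hwin : ∀ j'', j'' ≤ j → j ≤ j'' + M₁ → DECAtT x T₂ j'' M₂ (fun k => TP[q, h, c, k])) :
    BDECAtT x T₂ j M₂ M₁ (fun k => TP[q, h, c, k]) := by
  classical
  have hdecj : DECAtT x T₂ j M₂ (fun k => TP[q, h, c, k]) := hwin j le_rfl (Nat.le_add_right j M₁)
  -- the generic single-component witness `{q, h; c}`
  have witness : BValidAt x T₂ j M₁ q h c → BDECAtT x T₂ j M₂ M₁ (fun k => TP[q, h, c, k]) := by
    intro hval
    refine ⟨Unit, inferInstance, fun _ => 1, fun _ => c, fun _ => q, fun _ => h, fun _ => zero_le_one, by simp,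
      fun _ => ⟨hc0, hc1⟩, fun _ => hqh.le, fun _ => hhM, fun k => by simp, fun _ _ => hval⟩
  by_cases hqlow : q ≤ j ∧ 2 * (q : ℝ) < T₂
  swap
  · -- `q` is not a `j`-low: self-sufficient `lo`
    refine witness (Or.inr (Or.inl ⟨hqh, ?_⟩))
    by_cases hqj : q ≤ j
    · left; push Not at hqlow; exact hqlow hqj
    · right; omega
  obtain ⟨hqj, hlow⟩ := hqlow
  by_cases hgt : j + 1 ≤ h
  · -- giant absorber at layer j: x ≤ c
    have hxc := twoPoint_giant_ge x T₂ c j M₂ q h hx0 hx1 hc0 hc1 hqh hhM hqj hlow hgt hdecj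
    exact witness (Or.inl (Or.inr (Or.inl ⟨hqh, hgt, hxc⟩)))
  have hhj : h ≤ j := by omega
  rcases twoPoint_mid_ge x T₂ c j M₂ q h hx0 hx1 hc0 hc1 hqh hhM hqj hlow hhj hdecj with hc | ⟨hmid, hcomp, hgate⟩
  · -- c = 1: the law is δ_h, and h is self-sufficient (layer j ≥ h)
    subst hc
    have hss := twoPoint_notLow_of_one x T₂ j M₂ q h hx0 hx1 hqh hhM hhj hdecj
    refine ⟨Unit, inferInstance, fun _ => 1, fun _ => 1, fun _ => h, fun _ => h, fun _ => zero_le_one, by simp,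
      fun _ => ⟨zero_le_one, le_rfl⟩, fun _ => le_rfl, fun _ => hhM, fun k => ?_, fun _ _ => Or.inl (Or.inl ⟨rfl, Or.inl hss⟩)⟩
    simp
  -- h a compatible mid at layer j with pairGate ≤ c
  have hd : (0 : ℝ) < (h : ℝ) - q := by
    have : (q : ℝ) < h := by exact_mod_cast hqh
    linarith
  have hρc : (T₂ - 2 * (q : ℝ)) / ((h : ℝ) - q) ≤ c := le_trans (le_max_left _ _) hgate
  have hlc : x ^ 2 + (1 - x) * ((T₂ - 2 * (q : ℝ)) / ((h : ℝ) - q)) ≤ c := le_trans (le_max_right _ _) hgate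
  have hcredit : T₂ ≤ 2 * (q : ℝ) + ((h : ℝ) - q) * c := by
    have := (div_le_iff₀ hd).1 hρc
    linarith
  by_cases hstr : j < h + M₁
  · -- straddling: the layer h - 1 is in the window and h is a giant there, so x ≤ c: heavy-valid
    have hdec' : DECAtT x T₂ (h - 1) M₂ (fun k => TP[q, h, c, k]) := hwin (h - 1) (by omega) (by omega)
    have hxc := twoPoint_giant_ge x T₂ c (h - 1) M₂ q h hx0 hx1 hc0 hc1 hqh hhM (by omega) hlow (by omega) hdec'
    exact witness (Or.inl (Or.inr (Or.inr ⟨hqh, hhj, hxc, hcredit⟩)))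
  · -- below the straddle line: heavy-valid if x ≤ c, else a light credit pair with h + M₁ ≤ j
    have hbelow : h + M₁ ≤ j := by omega
    by_cases hxc : x ≤ c
    · exact witness (Or.inl (Or.inr (Or.inr ⟨hqh, hhj, hxc, hcredit⟩)))
    · push Not at hxc
      have hρ0 : 0 < (T₂ - 2 * (q : ℝ)) / ((h : ℝ) - q) := div_pos (by linarith) hd
      have h1x : 0 < 1 - x := by linarith
      have hx2c : x ^ 2 < c := by nlinarith [mul_pos h1x hρ0]
      have hcredit' : T₂ ≤ 2 * (q : ℝ) + ((h : ℝ) - q) * ((c - x ^ 2) / (1 - x)) := by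
        have h2 : (T₂ - 2 * (q : ℝ)) / ((h : ℝ) - q) ≤ (c - x ^ 2) / (1 - x) := by
          rw [le_div_iff₀ h1x]; nlinarith
        have := (div_le_iff₀ hd).1 h2
        linarith
      exact witness (Or.inr (Or.inr ⟨hqh, hbelow, hx2c, hxc, hcredit'⟩))

/-! ### `ConvClosedT` for a two-point factor -/

/-- **`ConvClosedT` HOLDS WHEN THE SECOND FACTOR HAS AT MOST TWO ATOMS.**  For `0 < x < 1`, a probability law `μ₁ ≥ 0` on `{0..M₁}`, positions
`q < h ≤ M₂`, a mass `0 ≤ c ≤ 1` and ANY real targets `T₁, T₂`: if `μ₁` is DEC at `T₁` at every layer `j″ ≤ j` with `j ≤ j″ + M₂` and the two-point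
law `{q, h; c}` is DEC at `T₂` at every layer `j″ ≤ j` with `j ≤ j″ + M₁`, then `lconv M₁ M₂ μ₁ {q, h; c}` is DEC at `(T₁ + T₂, j)` on `{0..M₁+M₂}`
(`twoPoint_bdecAtT` + the one-sided closure `lconv_decAtT_of_window_bdecAtT` with `sliceClosedWindowT_holds`). [this work] -/
theorem lconv_decAtT_of_window_twoPoint (x T₁ T₂ c : ℝ) (j M₁ M₂ q h : ℕ) (μ₁ : ℕ → ℝ) (hx0 : 0 < x) (hx1 : x < 1)
    (h10 : ∀ k, 0 ≤ μ₁ k) (h1M : ∀ k, M₁ < k → μ₁ k = 0) (h11 : ∑ k ∈ Finset.range (M₁ + 1), μ₁ k = 1)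
    (hc0 : 0 ≤ c) (hc1 : c ≤ 1) (hqh : q < h) (hhM : h ≤ M₂)
    (hwin₁ : ∀ j'', j'' ≤ j → j ≤ j'' + M₂ → DECAtT x T₁ j'' M₁ μ₁)
    (hwin₂ : ∀ j'', j'' ≤ j → j ≤ j'' + M₁ → DECAtT x T₂ j'' M₂ (fun k => TP[q, h, c, k])) :
    DECAtT x (T₁ + T₂) j (M₁ + M₂) (lconv M₁ M₂ μ₁ (fun k => TP[q, h, c, k])) :=
  lconv_decAtT_of_window_bdecAtT sliceClosedWindowT_holds x T₁ T₂ j M₁ M₂ μ₁ _ hx0 hx1 h10 h1M h11 hwin₁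
    (twoPoint_bdecAtT x T₂ c j M₁ M₂ q h hx0 hx1 hc0 hc1 hqh hhM hwin₂)

end LawDec

end Quant

end Summit.CriticalPhenomena.PercolationContinuityZ3.Theorems
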